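/-
Copyright (c) 2026 the pub-hodgecm-mathlib formalisation cell (harness21).  Prover seat hodgecm-mathlib-K2Liu-p10 (g0), Track B «K2-LIT»,
#184♮ = hLiu418 = `stmt-HodgeConjecture-24832`; SIGS-RoadI-v3 §Hol row H1-C (inverse direction, for the adelic Hol.3(c) assembly).
THEOREMS ONLY (no `def`, no `instance`, no named-fact hypothesis, no `sorry`).
-/
import Summits.HodgeConjecture.HodgeConjecture.Theorems.K2LiuHermitianTubeFrameArch
import HarnessLib

/-!
# Crux `HLiu418`, Road I, organ Hol-1 (H1-C), inverse transport: the per-place frame maps `archLocal … w` ONTO the tube group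
# `{Pᴴ J P = J}` — every tube-unitary `P` is `T g̃ T⁻¹` for some `g ∈ archLocal L (n+n) J^𝔻 w`

Cell `hodgecm-mathlib`, crux item hLiu418 = `stmt-HodgeConjecture-24832` (helper lane, count-neutral).  Sequel of ★ `K2LiuHermitianTubeFrameArch`
(`exists_tubeFrame_arch`: `archLocal → {PᴴJP = J}`, `P_Δ ↦ {C = 0}`, `N_Δ ↠ Herm`).  Here:
* §1 letters: `Tᴴ K T = H`, `T T' = 1 ⇒ T'ᴴ H T' = K`; the inverse of a tube-unitary, `P⁻¹ = −J Pᴴ J` (`J² = −1`);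
* §2 THE TWO-SIDED PACKAGE `exists_tubeFrame_arch₂`: the conjuncts of `exists_tubeFrame_arch` for ONE frame `(T, T⁻¹)` PLUS
  (v) `T⁻¹ᴴ (diag t_w ⊕ −diag t_w) T⁻¹ = i·J` and (vi) SURJECTIVITY: for every `P` with `Pᴴ J P = J` there is `g ∈ archLocal … w` with
  `T g̃ T⁻¹ = P` (namely `g̃ = T⁻¹ P T`, inverse `T⁻¹ (−J Pᴴ J) T`) — so `g ↦ T g̃ T⁻¹` is a bijection `archLocal … w ≃ {Pᴴ J P = J}`, which is
  what lets the adelic assembly define the tube-side `Φ(P) := F(archToAdelic g_P · x)` on ALL of `∏_w U(J)`.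
Sources: [Shimura1997, §§5–6]; [GelbartRogawski1991, §3.1].
HONEST LABEL.  Helper lemmas, count-neutral; `HC_CM` is proved only modulo the 7 printed citations (2 remaining named inputs:
hLiu418 = `stmt-HodgeConjecture-24832`, h413 = `stmt-HodgeConjecture-24833`) until rung 0 closes.
-/

set_option autoImplicit false
set_option linter.dupNamespace false -- the mandated namespace repeats `HodgeConjecture.HodgeConjecture`

namespace Summit.HodgeConjecture.HodgeConjecture.Cruxes.HLiu418.K2LiuHermitianTubeFrameArchInv

open Matrix Complex NumberField
open scoped MatrixGroups ComplexConjugate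
open Literature.NumberTheory.Automorphic Literature.NumberTheory.Automorphic.UnitaryGroup
open Literature.NumberTheory.GelbartRogawski1991 Literature.NumberTheory.GelbartRogawski1991.GRConstruction
open K2LiuHermitianTubeCocycle K2LiuHermitianTubeFrame K2LiuHermitianTubeFrameArch K2LiuSiegelUnipotentLocalDefs

/-! ## 1. Letters -/

/-- If `Tᴴ K T = H` and `T T' = 1` then `T'ᴴ H T' = K`. [folklore] -/
theorem conjTranspose_inv_mul_mul_inv {m : Type*} [Fintype m] [DecidableEq m] {T T' K H : Matrix m m ℂ} (hT : Tᴴ * K * T = H)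
    (h1 : T * T' = 1) : T'ᴴ * H * T' = K := by
  rw [← hT]
  calc T'ᴴ * (Tᴴ * K * T) * T' = (T * T')ᴴ * K * (T * T') := by rw [conjTranspose_mul]; simp only [Matrix.mul_assoc]
    _ = K := by rw [h1, conjTranspose_one, Matrix.one_mul, Matrix.mul_one]

/-- **The inverse of a tube-unitary**: `Pᴴ J P = J ⇒ (−J Pᴴ J) P = 1`. [cite: Shimura1997, §5.1] -/
theorem neg_J_conjTranspose_J_mul {l : Type*} [Fintype l] [DecidableEq l] {P : Matrix (l ⊕ l) (l ⊕ l) ℂ}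
    (hP : Pᴴ * Matrix.J l ℂ * P = Matrix.J l ℂ) : -(Matrix.J l ℂ * Pᴴ * Matrix.J l ℂ) * P = 1 := by
  rw [Matrix.neg_mul, Matrix.mul_assoc, Matrix.mul_assoc, ← Matrix.mul_assoc Pᴴ, hP, Matrix.J_squared, neg_neg]

/-- … and `P (−J Pᴴ J) = 1`. [cite: Shimura1997, §5.1] -/
theorem mul_neg_J_conjTranspose_J {l : Type*} [Fintype l] [DecidableEq l] {P : Matrix (l ⊕ l) (l ⊕ l) ℂ}
    (hP : Pᴴ * Matrix.J l ℂ * P = Matrix.J l ℂ) : P * -(Matrix.J l ℂ * Pᴴ * Matrix.J l ℂ) = 1 :=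
  mul_eq_one_comm.1 (neg_J_conjTranspose_J_mul hP)

/-- A tube-unitary `P` transported back, `T' P T`, preserves `H` whenever `Tᴴ (i·J) T = H`, `T T' = 1 = T' T`. [cite: Shimura1997, §5.1] -/
theorem inv_conj_preserves {l : Type*} [Fintype l] [DecidableEq l] {T T' H P : Matrix (l ⊕ l) (l ⊕ l) ℂ}
    (hT : Tᴴ * (I • Matrix.J l ℂ) * T = H) (h1 : T * T' = 1) (h2 : T' * T = 1) (hP : Pᴴ * Matrix.J l ℂ * P = Matrix.J l ℂ) :
    (T' * P * T)ᴴ * H * (T' * P * T) = H := by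
  have hP' : Pᴴ * (I • Matrix.J l ℂ) * P = I • Matrix.J l ℂ := by rw [Matrix.mul_smul, Matrix.smul_mul, hP]
  exact conjTranspose_conj_mul_mul_conj (conjTranspose_inv_mul_mul_inv hT h1) h2 hP'

/-! ## 2. The two-sided per-place package -/

variable (L : Type) [Field L] [NumberField L] [IsCMField L] {N M n : ℕ} (e : Fin N × Fin M ≃ Fin n)
  (dV : Fin N → L) (hdV : ∀ i, IsCMField.complexConj L (dV i) = dV i)
  (dW : Fin M → L) (hdW : ∀ i, IsCMField.complexConj L (dW i) = dW i)
  (w : {w : InfinitePlace L // w.IsComplex})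

/-- **THE TWO-SIDED PER-PLACE FRAME PACKAGE.**  As ★ `exists_tubeFrame_arch`, for ONE frame `(T, T⁻¹)`, plus surjectivity: every `P`
with `Pᴴ J P = J` is `T g̃ T⁻¹` for some `g ∈ archLocal L (n+n) J^𝔻 w`. [cite: Shimura1997, §§5–6] -/
theorem exists_tubeFrame_arch₂ (hw : IsCMField.complexConj L • w.1 = w.1) (hdV0 : ∀ i, dV i ≠ 0) (hdW0 : ∀ j, dW j ≠ 0) :
    ∃ T Tinv : Matrix (Fin n ⊕ Fin n) (Fin n ⊕ Fin n) ℂ, T * Tinv = 1 ∧ Tinv * T = 1 ∧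
      (∀ g : GL (Fin (n + n)) ℂ, g ∈ archLocal L (n + n) (hermD L e dV hdV dW hdW) w →
        (T * Matrix.reindex (e₂ (n := n)).symm (e₂ (n := n)).symm (g : Matrix _ _ ℂ) * Tinv)ᴴ * Matrix.J (Fin n) ℂ *
          (T * Matrix.reindex (e₂ (n := n)).symm (e₂ (n := n)).symm (g : Matrix _ _ ℂ) * Tinv) = Matrix.J (Fin n) ℂ) ∧
      (∀ g : GL (Fin (n + n)) ℂ, IsSiegelM (n := n) (g : Matrix (Fin (n + n)) (Fin (n + n)) ℂ) →
        (T * Matrix.reindex (e₂ (n := n)).symm (e₂ (n := n)).symm (g : Matrix _ _ ℂ) * Tinv).toBlocks₂₁ = 0) ∧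
      (∀ u : GL (Fin (n + n)) ℂ, u ∈ archLocal L (n + n) (hermD L e dV hdV dW hdW) w → IsUnipM (n := n) (u : Matrix (Fin (n + n)) (Fin (n + n)) ℂ) →
        ∃ b : Matrix (Fin n) (Fin n) ℂ, bᴴ = b ∧
          T * Matrix.reindex (e₂ (n := n)).symm (e₂ (n := n)).symm (u : Matrix _ _ ℂ) * Tinv = fromBlocks 1 b 0 1) ∧
      (∀ b : Matrix (Fin n) (Fin n) ℂ, bᴴ = b → ∃ u : GL (Fin (n + n)) ℂ,
        u ∈ archLocal L (n + n) (hermD L e dV hdV dW hdW) w ∧ IsUnipM (n := n) (u : Matrix (Fin (n + n)) (Fin (n + n)) ℂ) ∧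
          T * Matrix.reindex (e₂ (n := n)).symm (e₂ (n := n)).symm (u : Matrix _ _ ℂ) * Tinv = fromBlocks 1 b 0 1) ∧
      (∀ P : Matrix (Fin n ⊕ Fin n) (Fin n ⊕ Fin n) ℂ, Pᴴ * Matrix.J (Fin n) ℂ * P = Matrix.J (Fin n) ℂ →
        ∃ g : GL (Fin (n + n)) ℂ, g ∈ archLocal L (n + n) (hermD L e dV hdV dW hdW) w ∧
          T * Matrix.reindex (e₂ (n := n)).symm (e₂ (n := n)).symm (g : Matrix _ _ ℂ) * Tinv = P) := by
  obtain ⟨T, Tinv, h1, h2, hT, hS, hU, hB⟩ :=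
    exists_tubeFrame (fun k => (w.1.embedding (dV (e.symm k).1 * dW (e.symm k).2)).re) (tw_ne_zero L e dV hdV dW hdW w hw hdV0 hdW0)
  refine ⟨T, Tinv, h1, h2, fun g hg => ?_, fun g hg => hS _ hg, fun u hu hU' => ?_, fun b hb => ?_, fun P hP => ?_⟩
  · exact conj_mem_UJ hT h1 ((mem_archLocal_hermD_iff L e dV hdV dW hdW w hw g).1 hg)
  · have hshape := (isUnip_blocks_iff _).1 hU'
    set φ := (Matrix.reindex (e₂ (n := n)).symm (e₂ (n := n)).symm (u : Matrix _ _ ℂ)).toBlocks₂₁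
    obtain ⟨b, hb, hherm⟩ := hU φ
    refine ⟨b, hherm ?_, by rw [hshape]; exact hb⟩
    have hmem := (mem_archLocal_hermD_iff L e dV hdV dW hdW w hw u).1 hu
    rw [hshape] at hmem
    exact (unip_conjTranspose_mul_form_mul_iff (by rw [diagonal_conjTranspose]; simp [Pi.star_def]) φ).1 hmem
  · obtain ⟨φ, hskew, hφ⟩ := hB b hb
    have hunit : (fromBlocks (1 + φ) (-φ) φ (1 - φ))ᴴ *
        fromBlocks (diagonal fun k => (((w.1.embedding (dV (e.symm k).1 * dW (e.symm k).2)).re : ℝ) : ℂ)) 0 0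
          (-diagonal fun k => (((w.1.embedding (dV (e.symm k).1 * dW (e.symm k).2)).re : ℝ) : ℂ)) *
        fromBlocks (1 + φ) (-φ) φ (1 - φ) = _ :=
      (unip_conjTranspose_mul_form_mul_iff (by rw [diagonal_conjTranspose]; simp [Pi.star_def]) φ).2 hskew
    let U : Matrix (Fin (n + n)) (Fin (n + n)) ℂ := Matrix.reindex (e₂ (n := n)) (e₂ (n := n)) (fromBlocks (1 + φ) (-φ) φ (1 - φ))
    let Uinv : Matrix (Fin (n + n)) (Fin (n + n)) ℂ :=
      Matrix.reindex (e₂ (n := n)) (e₂ (n := n)) (fromBlocks (1 - φ) φ (-φ) (1 + φ))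
    have hUU : U * Uinv = 1 := by
      show Matrix.reindex _ _ _ * Matrix.reindex _ _ _ = 1
      rw [reindex_apply, reindex_apply, submatrix_mul_equiv, unip_mul_unip_neg, submatrix_one_equiv]
    have hUU' : Uinv * U = 1 := by
      show Matrix.reindex _ _ _ * Matrix.reindex _ _ _ = 1
      rw [reindex_apply, reindex_apply, submatrix_mul_equiv, unip_neg_mul_unip, submatrix_one_equiv]
    refine ⟨⟨U, Uinv, hUU, hUU'⟩, ?_, isUnipM_reindex_unip φ, ?_⟩
    · rw [mem_archLocal_hermD_iff L e dV hdV dW hdW w hw]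
      show (Matrix.reindex _ _ U)ᴴ * _ * Matrix.reindex _ _ U = _
      simp only [U, reindex_symm_reindex]
      exact hunit
    · show T * Matrix.reindex _ _ U * Tinv = _
      simp only [U, reindex_symm_reindex]
      exact hφ
  · -- surjectivity: `g̃ = Tinv P T`, inverse `Tinv (−J Pᴴ J) T`
    let G : Matrix (Fin (n + n)) (Fin (n + n)) ℂ := Matrix.reindex (e₂ (n := n)) (e₂ (n := n)) (Tinv * P * T)
    let Ginv : Matrix (Fin (n + n)) (Fin (n + n)) ℂ :=
      Matrix.reindex (e₂ (n := n)) (e₂ (n := n)) (Tinv * -(Matrix.J (Fin n) ℂ * Pᴴ * Matrix.J (Fin n) ℂ) * T)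
    have hGG : G * Ginv = 1 := by
      show Matrix.reindex _ _ _ * Matrix.reindex _ _ _ = 1
      rw [reindex_apply, reindex_apply, submatrix_mul_equiv, show Tinv * P * T * (Tinv * -(Matrix.J (Fin n) ℂ * Pᴴ * Matrix.J (Fin n) ℂ) * T) =
        Tinv * (P * ((T * Tinv) * -(Matrix.J (Fin n) ℂ * Pᴴ * Matrix.J (Fin n) ℂ))) * T by simp only [Matrix.mul_assoc], h1, Matrix.one_mul,
        mul_neg_J_conjTranspose_J hP, Matrix.mul_one, h2, submatrix_one_equiv]
    have hGG' : Ginv * G = 1 := by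
      show Matrix.reindex _ _ _ * Matrix.reindex _ _ _ = 1
      rw [reindex_apply, reindex_apply, submatrix_mul_equiv, show Tinv * -(Matrix.J (Fin n) ℂ * Pᴴ * Matrix.J (Fin n) ℂ) * T * (Tinv * P * T) =
        Tinv * (-(Matrix.J (Fin n) ℂ * Pᴴ * Matrix.J (Fin n) ℂ) * ((T * Tinv) * P)) * T by simp only [Matrix.mul_assoc], h1, Matrix.one_mul,
        neg_J_conjTranspose_J_mul hP, Matrix.mul_one, h2, submatrix_one_equiv]
    refine ⟨⟨G, Ginv, hGG, hGG'⟩, ?_, ?_⟩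
    · rw [mem_archLocal_hermD_iff L e dV hdV dW hdW w hw]
      show (Matrix.reindex _ _ G)ᴴ * _ * Matrix.reindex _ _ G = _
      simp only [G, reindex_symm_reindex]
      exact inv_conj_preserves hT h1 h2 hP
    · show T * Matrix.reindex _ _ G * Tinv = P
      simp only [G, reindex_symm_reindex]
      rw [show T * (Tinv * P * T) * Tinv = (T * Tinv) * P * (T * Tinv) by simp only [Matrix.mul_assoc], h1, Matrix.one_mul,
        Matrix.mul_one]

end Summit.HodgeConjecture.HodgeConjecture.Cruxes.HLiu418.K2LiuHermitianTubeFrameArchInv
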